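import Literature.Barriers.QuantumAdvantage.AaronsonChenOracleProofs
import Literature.Barriers.QuantumAdvantage.AaronsonChenSimulationProofs
import Literature.Barriers.QuantumAdvantage.SampPRelSubsetSampBQPRel
import Literature.Computability.QuantumComplexity.CoinFamilyKernelProofs
import HarnessLib

/-!
# Aaronson–Chen 2017, Thm. 5.1 (sampling bullet): down to the `SampBPP^{TQBF,O}` machine of Lemma 5.3

Proof file (D-0014: theorems only, no definitions, no named facts) composing the reductions and
discharges now in the tree for

* S. Aaronson, L. Chen, *Complexity-theoretic foundations of quantum supremacy experiments*,
  CCC 2017 (arXiv:1612.05903) [AaronsonChen2017], **Theorem 5.1, first bullet** (p. 21):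
  `SampBPP^{TQBF,O} = SampBQP^{TQBF,O}` with probability `1` over `O ∼ 𝒟_O` — the named fact
  `aaronsonChen2017_thm51_samp` of `AaronsonChenOracle.lean`.

State of its proof tree (2026-08-15): the printed proof (p. 21, from Lemma 5.3 by a.s. glue; the
trivial inclusion `SampBPP^A ⊆ SampBQP^A`) is formalized as
`aaronsonChen2017_thm51_samp_of_lem53` (`AaronsonChenOracleProofs.lean`: union bound over the
bad pairs `(x, k)`, accuracy doubling, countability of the machines) and
`SampPRel_subset_SampBQPRel_of_sim` (`SampPRelSubsetSampBQPRel.lean`) fed with the relativized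
reversible simulation `uniformOracleCoinSimulation_holds` (`CoinFamilyKernelProofs.lean`; the
composite is also recorded as `SampPRel_subset_SampBQPRel_holds` in `SampPRelSubsetSampBQPRelHolds.lean`); Lemma 5.3 itself is
`aaronsonChen2017_lem53_of_machine` (`AaronsonChenSimulationProofs.lean`: the hybrid/BBBV
analysis and the posterior-Chernoff bound `aaronsonChen2017_lem53_losses_holds` are proved).
Hence the sampling bullet of Thm. 5.1 — and the §5.3 inclusion
`aaronsonChen2017_thm51_sampBQP_subset` — rest on exactly ONE named fact, the
`SampBPP^{TQBF,O}` simulator `aaronsonChen2017_lem53_machine` ("all the computations can be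
done in `PSPACE`, and therefore can be implemented in `poly(n, 1/ε)` time with the help of the
`TQBF` oracle", p. 23):

* `aaronsonChen2017_thm51_sampBQP_subset_of_machine`,
* `aaronsonChen2017_thm51_samp_of_machine`.

The discharge `aaronsonChen2017_thm51_samp_holds` is the second theorem applied to
`aaronsonChen2017_lem53_machine_holds` once that lands.

## References

* [AaronsonChen2017] S. Aaronson, L. Chen, CCC 2017, LIPIcs 79, 22:1–22:67
  (doi:10.4230/LIPIcs.CCC.2017.22; arXiv:1612.05903), Thm. 5.1 and its proof (p. 21), Lemma 5.3
  (pp. 21–23), read via `lit read arxiv:1612.05903 --pages 20-24`.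
-/

namespace Literature.Barriers.QuantumAdvantage

open Literature.Computability.QuantumComplexity

/-- **§5.3 of Aaronson–Chen from the machine of Lemma 5.3**: a.s. over `O ∼ 𝒟_O`,
`SampBQP^{TQBF,O} ⊆ SampBPP^{TQBF,O}`, given only the `SampBPP^{TQBF,O}` simulator
`aaronsonChen2017_lem53_machine` (Lemma 5.3 by `aaronsonChen2017_lem53_of_machine`, then the
a.s. glue `aaronsonChen2017_thm51_sampBQP_subset_of_lem53`).
[cite: AaronsonChen2017, §5.3 (pp. 21–23) and proof of Thm. 5.1 (p. 21)] -/
theorem aaronsonChen2017_thm51_sampBQP_subset_of_machine (hM : aaronsonChen2017_lem53_machine) :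
    aaronsonChen2017_thm51_sampBQP_subset :=
  aaronsonChen2017_thm51_sampBQP_subset_of_lem53 (aaronsonChen2017_lem53_of_machine hM)

/-- **Thm. 5.1, sampling bullet, from the machine of Lemma 5.3**: a.s. over `O ∼ 𝒟_O`,
`SampBPP^{TQBF,O} = SampBQP^{TQBF,O}`, given only `aaronsonChen2017_lem53_machine` (the other
inclusion `SampBPP^A ⊆ SampBQP^A` is `SampPRel_subset_SampBQPRel_of_sim uniformOracleCoinSimulation_holds`,
through `aaronsonChen2017_thm51_samp_of_leaves`).
[cite: AaronsonChen2017, Thm. 5.1 (p. 21, first bullet) and Lemma 5.3] -/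
theorem aaronsonChen2017_thm51_samp_of_machine (hM : aaronsonChen2017_lem53_machine) :
    aaronsonChen2017_thm51_samp :=
  aaronsonChen2017_thm51_samp_of_leaves (aaronsonChen2017_lem53_of_machine hM)
    uniformOracleCoinSimulation_holds

end Literature.Barriers.QuantumAdvantage
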